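import Summits.BirchSwinnertonDyer.Rank1Residual.X5.SelmerSolitairePivotAux
import HarnessLib

/-!
# Principal pivot transform: uniqueness from the exchange relation

Cell `b2b-bsdres`, O1 (p = 2) PROVER ORDER v2.8 (ii′) support (x11b3-p4; item (R2) of
`HOME/b2b-bsdres-x11b3-p4/T4PRIME-PLAN.md`: "pivot of an extension = extension of the pivot" is proved by
checking the exchange relation, thanks to this uniqueness).  Pure linear algebra over a field; reach-neutral;
nothing booked; O1 OPEN.  Theorems only.

* `piecewise_mulVec_surjective` — when `M[A]` is invertible, every vector is `(Mx|_A, x|_B)` for some `x`.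
* `eq_pivot_of_exchange` — a matrix satisfying the exchange relation of `pivot M A` IS `pivot M A`.

[cite: Tsatsomeros2000, Thm. 3.1]
-/

namespace Summit.BirchSwinnertonDyer.Rank1Residual.X5.SelmerSolitaire

open Finset Matrix

variable {ι : Type*} [Fintype ι] [DecidableEq ι] {𝔽 : Type*} [Field 𝔽] {M : Matrix ι ι 𝔽} {A : Finset ι}

/-- When `M[A]` is invertible, `x ↦ (Mx|_A, x|_B)` is onto: `z = (Mx|_A, x|_B)` for
`x = ((pivot M A) z|_A, z|_B)` (the backward exchange relation). [cite: Tsatsomeros2000, Lemma 3.3] -/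
theorem piecewise_mulVec_surjective (hA : IsUnit (M.submatrix (Subtype.val : ↥A → ι) Subtype.val).det)
    (z : ι → 𝔽) : ∃ x : ι → 𝔽, A.piecewise (M *ᵥ x) x = z := by
  classical
  refine ⟨A.piecewise (pivot M A *ᵥ z) z, ?_⟩
  have h := mulVec_piecewise_pivot hA z
  funext i
  by_cases hi : i ∈ A
  · rw [Finset.piecewise_eq_of_mem _ _ _ hi, h, Finset.piecewise_eq_of_mem _ _ _ hi]
  · rw [Finset.piecewise_eq_of_notMem _ _ _ hi, Finset.piecewise_eq_of_notMem _ _ _ hi]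

/-- **Uniqueness of the principal pivot transform**: a matrix `Q` with
`Q (Mx|_A, x|_B) = (x|_A, Mx|_B)` for all `x` equals `pivot M A`. [cite: Tsatsomeros2000, Thm. 3.1] -/
theorem eq_pivot_of_exchange (hA : IsUnit (M.submatrix (Subtype.val : ↥A → ι) Subtype.val).det)
    (Q : Matrix ι ι 𝔽) (hQ : ∀ x : ι → 𝔽, Q *ᵥ A.piecewise (M *ᵥ x) x = A.piecewise x (M *ᵥ x)) :
    Q = pivot M A := by
  classical
  have hvec : ∀ z : ι → 𝔽, Q *ᵥ z = pivot M A *ᵥ z := fun z => by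
    obtain ⟨x, rfl⟩ := piecewise_mulVec_surjective hA z
    rw [hQ, pivot_mulVec_piecewise hA]
  ext i j
  have h := congrFun (hvec (Pi.single j 1)) i
  simpa [Matrix.mulVec, dotProduct, Pi.single_apply, Finset.sum_ite_eq', Finset.mem_univ] using h

end Summit.BirchSwinnertonDyer.Rank1Residual.X5.SelmerSolitaire
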